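import Summits.QuantumAdvantage.QuantumAdvantage.Theorems.GradeDialB

/-! # AbsorptionDialQuasiLossBridgeOdd — closes the support item `Theses.AbsorptionDial.QuasiLossBridgeOdd`

Route `route-QuantumAdvantage-AbsorptionDial` rev 1 (writer decomp-qadv-writer-1 g9, 2026-08-31; lens-5 g25 node «GradeDial»,
critic 74v20): the walk-grain bridge at the QUASI grade, `Q = WalkQuasiLossOdd ⟹ DetSepOdd` (stmt-QuantumAdvantage-28403),
is the composition of the two landed GradeDial twins: the graded walk → ring transport `ringQuasi_of_walkQuasi`
(`Theorems/GradeDialB`, exponent `A ↦ A + 1`) and Razborov–Smolensky with the graded error budget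
`detSepOdd_of_ringQuasiLoss8Odd` (`Theorems/GradeDialA`). This 8-line closer states it BY NAME on the route decl
(the node's own `GradeDial.quasiLossBridgeOdd_holds` lives in the lens folder, not in the tree). -/

set_option linter.dupNamespace false -- D-0017: single-problem summit (Summit.QuantumAdvantage.QuantumAdvantage)

namespace Summit.QuantumAdvantage.QuantumAdvantage.Theorems.GradeDial

/-- **closes stmt-QuantumAdvantage-28403** (`AbsorptionDial.QuasiLossBridgeOdd : WalkQuasiLossOdd-inlined → DetSepOdd`):
walk quasi grade with exponent `A` ⟹ ring quasi grade with exponent `A + 1` at every length `8t ≥ N₀(c)`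
(`ringQuasi_of_walkQuasi`) ⟹ `DetSepOdd` (`detSepOdd_of_ringQuasiLoss8Odd`). -/
theorem quasiLossBridgeOdd_holds :
    Summit.QuantumAdvantage.QuantumAdvantage.Theses.AbsorptionDial.QuasiLossBridgeOdd := by
  intro hQ
  refine detSepOdd_of_ringQuasiLoss8Odd fun p _ hp => ?_
  obtain ⟨A, hA⟩ := hQ p hp
  refine ⟨A + 1, fun c => ?_⟩
  obtain ⟨N₀, hN₀⟩ := ringQuasi_of_walkQuasi p hA c
  exact ⟨N₀, fun t ht P hP => hN₀ (8 * t) (by omega) P hP⟩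

end Summit.QuantumAdvantage.QuantumAdvantage.Theorems.GradeDial
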